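import Summits.KontsevichZagierPeriods.KontsevichZagierPeriods.Theorems.ZagierDilogarithmConjecture.Negative.Mirror
import Summits.KontsevichZagierPeriods.KontsevichZagierPeriods.Theorems.ZagierDilogarithmConjecture.Negative.DehnWitness

/-!
# `ZagierDilogarithmConjecture` (stmt-KontsevichZagierPeriods-10550) — negative knowledge IV: load-bearing hypotheses via the Dehn invariant, and the strength of the conjecture

`zagier_false_without_posIm` (the crux with `0 < Im zᵢ` deleted is FALSE: witness
`z₀ = (2 − 4i)/5`, `T(z₀) = ∅`, `δ[z₀] = 2`), `zagier_false_without_volumeHyp` (with the volume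
hypothesis deleted it is FALSE: `[(2 + 4i)/5]` is outside the relator span — the conclusion of
the conjecture is not vacuous), and `crux_implies_indep`: the conjecture implies that
`vol T((2+4i)/5)` and `vol T(i)` (Catalan's constant `G = D(i)`) are `ℤ`-linearly independent,
i.e. `D((2+4i)/5)/G ∉ ℚ`, an open irrationality statement (Neumann 1998 §1) — its content on
`ker δ` (`δ[i] = 0`, `asym_I`), where no algebraic invariant decides.
Sorry-free, axioms ⊆ {propext, Classical.choice, Quot.sound}.
-/

noncomputable section

open Complex MeasureTheory Set
open scoped ComplexConjugate

namespace Summit.KontsevichZagierPeriods.HyperbolicBloch.ZagierDilogarithmConjectureNegative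

open Literature.NumberTheory.Transcendental
open Summit.KontsevichZagierPeriods.KontsevichZagierPeriods.Theses.HyperbolicBloch
  (ZagierDilogarithmConjecture)
open Summit.KontsevichZagierPeriods.HyperbolicBloch.FiveTermTransferNegative
  (L not_isAlgebraic_L xL xL_re xL_im not_isAlgebraic_xL isAlgebraic_of_eq_rat)

/-! ## §6 Load-bearing hypotheses certified by the Dehn invariant -/

/-- `z₀` and `z̄₀` are algebraic (Gaussian rationals). [folklore] -/
theorem isAlgebraic_z₀ : IsAlgebraic ℚ z₀ :=
  isAlgebraic_of_eq_rat (2 / 5) (-(4 / 5)) (by rw [z₀_eq]; push_cast; ring)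

/-- Auxiliary: `isAlgebraic_conj_z₀`. [folklore] -/
theorem isAlgebraic_conj_z₀ : IsAlgebraic ℚ (conj z₀) :=
  isAlgebraic_z₀.algHom (starRingEnd ℂ).toRatAlgHom

/-- Auxiliary: `conj_z₀_im`. [folklore] -/
theorem conj_z₀_im : (conj z₀).im = 4 / 5 := by rw [conj_im, z₀_im, neg_neg]

/-- **The crux with the hypothesis `∀ i, 0 < Im (z i)` dropped.** -/
def ZagierWithoutPosIm : Prop :=
  ∀ (k : ℕ) (z : Fin k → ℂ) (n : Fin k → ℤ), (∀ i, IsAlgebraic ℚ (z i)) →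
    ∑ i, (n i : ℝ) * idealTetrahedronVolume (z i) = 0 →
      (∑ i, n i • FreeAbelianGroup.of (z i)) ∈ AddSubgroup.closure dilogRelators

/-- **Any proof must use `0 < Im zᵢ`.** Witness `k = 1`, `z = z₀ = (2 − 4i)/5`, `n = 1`:
`T(z₀) = ∅` (§1) so the volume hypothesis holds, but `δ[z₀] = 2 ≠ 0` while `δ` kills the relator
subgroup. (Lower-half-plane parameters must enter with the sign `B(w̄) = −B(w)`.) [folklore] -/
theorem zagier_false_without_posIm : ¬ ZagierWithoutPosIm := by
  intro h
  have hvol : ∑ i : Fin 1, ((![1] : Fin 1 → ℤ) i : ℝ) *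
      idealTetrahedronVolume ((![z₀] : Fin 1 → ℂ) i) = 0 := by
    simp [idealTetrahedronVolume_eq_zero_of_im_nonpos (z := z₀) (by rw [z₀_im]; norm_num)]
  have hmem := h 1 ![z₀] ![1] (fun i => by fin_cases i; exact isAlgebraic_z₀) hvol
  exact of_z₀_not_mem (by simpa using hmem)

/-- **The crux with the volume hypothesis dropped** ("every formal combination of algebraic
upper-half-plane points is in the relator span"). -/
def ZagierWithoutVolumeHyp : Prop :=
  ∀ (k : ℕ) (z : Fin k → ℂ) (n : Fin k → ℤ), (∀ i, IsAlgebraic ℚ (z i)) → (∀ i, 0 < (z i).im) →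
    (∑ i, n i • FreeAbelianGroup.of (z i)) ∈ AddSubgroup.closure dilogRelators

/-- **The conclusion is not vacuous / any proof must use the volume hypothesis**: the relator
subgroup is a PROPER subgroup on the algebraic upper half plane — `[(2 + 4i)/5]` is not in it
(`δ = −2`). [folklore] -/
theorem zagier_false_without_volumeHyp : ¬ ZagierWithoutVolumeHyp := by
  intro h
  have hmem := h 1 ![conj z₀] ![1] (fun i => by fin_cases i; exact isAlgebraic_conj_z₀)
    (fun i => by fin_cases i; show 0 < (conj z₀).im; rw [conj_z₀_im]; norm_num)
  exact of_conj_z₀_not_mem (by simpa using hmem)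

/-! ## §7 Strength: the crux proves an open irrationality statement -/

/-- The Dehn invariant vanishes at `i` (`i` and `−i` are roots of unity, `1 ∓ i` do not matter):
`[i]` is a genuine Bloch-group element. [folklore] -/
theorem asym_I : asym uu vv I = 0 := by
  have hI : ext uu I = 0 := ext_eq_zero_of_pow_eq_one uu (n := 4) (by norm_num) (by simp)
  have hI' : ext vv I = 0 := ext_eq_zero_of_pow_eq_one vv (n := 4) (by norm_num) (by simp)
  have h4 : (-I : ℂ) ^ 4 = 1 := by rw [neg_pow I 4]; norm_num
  have hnI : ext uu (-I) = 0 := ext_eq_zero_of_pow_eq_one uu (n := 4) (by norm_num) h4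
  have hnI' : ext vv (-I) = 0 := ext_eq_zero_of_pow_eq_one vv (n := 4) (by norm_num) h4
  simp [asym, sym, hI, hI', hnI, hnI']

/-- **What any proof of the crux would prove**: `vol T((2+4i)/5)` and `vol T(i)` (= Catalan's
constant `G = D(i)`) are `ℤ`-linearly independent, i.e. `D((2+4i)/5) / G ∉ ℚ` — an open
irrationality statement (Neumann 1998 §1: "it is not known if a single one of them is
[irrational]"). Proof: a relation `a·vol + b·G = 0` would put `a[(2+4i)/5] + b[i]` in the relator
span; `δ` gives `−2a + 0 = 0`, then `b·G = 0` with `G > 0`.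
[cite: Neumann1998, §1 (discussion after Conjecture 1.5)] -/
theorem crux_implies_indep (hZ : ZagierDilogarithmConjecture) (a b : ℤ)
    (hab : (a : ℝ) * idealTetrahedronVolume (conj z₀) + (b : ℝ) * idealTetrahedronVolume I = 0) :
    a = 0 ∧ b = 0 := by
  have hZ' := crux_iff.mp hZ
  have halg : ∀ j : Fin 2, IsAlgebraic ℚ ((![conj z₀, I] : Fin 2 → ℂ) j) := by
    intro j; fin_cases j
    · exact isAlgebraic_conj_z₀
    · exact (isAlgebraic_of_eq_rat 0 1 (by push_cast; ring))
  have him : ∀ j : Fin 2, 0 < ((![conj z₀, I] : Fin 2 → ℂ) j).im := by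
    intro j; fin_cases j
    · show 0 < (conj z₀).im; rw [conj_z₀_im]; norm_num
    · simp
  have hvol : ∑ j : Fin 2, ((![a, b] : Fin 2 → ℤ) j : ℝ) *
      idealTetrahedronVolume ((![conj z₀, I] : Fin 2 → ℂ) j) = 0 := by
    simpa [Fin.sum_univ_two] using hab
  have hmem := hZ' 2 ![conj z₀, I] ![a, b] halg him hvol
  have h0 := dehn_eq_zero_of_mem_closure uu vv hmem
  have h1 : dehn uu vv (∑ j : Fin 2, (![a, b] : Fin 2 → ℤ) j •
      FreeAbelianGroup.of ((![conj z₀, I] : Fin 2 → ℂ) j)) =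
      a • asym uu vv (conj z₀) + b • asym uu vv I := by
    rw [Fin.sum_univ_two]
    simp only [Matrix.cons_val_zero, Matrix.cons_val_one, Matrix.cons_val_fin_one, map_add,
      map_zsmul, dehn_of]
  rw [h1, asym_conj_z₀, asym_I, smul_zero, add_zero, zsmul_eq_mul] at h0
  have ha : a = 0 := by
    have : (a : ℚ) = 0 := by linarith
    exact_mod_cast this
  subst ha
  refine ⟨rfl, ?_⟩
  have hG : 0 < idealTetrahedronVolume I := idealTetrahedronVolume_pos (by simp)
  have : (b : ℝ) * idealTetrahedronVolume I = 0 := by simpa using hab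
  rcases mul_eq_zero.mp this with hb | hb
  · exact_mod_cast hb
  · exact absurd hb hG.ne'

end Summit.KontsevichZagierPeriods.HyperbolicBloch.ZagierDilogarithmConjectureNegative

end
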